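import Summits.BirchSwinnertonDyer.BirchSwinnertonDyer.Theorems.ByReductionTypeAtTwoSupersingularFlatDivAmbient
import Summits.BirchSwinnertonDyer.BirchSwinnertonDyer.Theorems.ByReductionTypeAtTwoSupersingularFlatConjModSelmer
import Summits.BirchSwinnertonDyer.Rank1Residual.X2.GreenbergVatsalUnramifiedAway
import Literature.NumberTheory.EllipticCurves.GreenbergVatsal2000.NonPrimitiveDatumSelmerInvariants
import Literature.NumberTheory.EllipticCurves.IwasawaSelmerControlLocalizationProofs
import Literature.NumberTheory.EllipticCurves.SubgroupSelmerProofs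
import HarnessLib

/-!
# The «LIFT» assembly at LEVEL `K` (`H¹(Γ_K, E[p^∞])`, the currency of Cassels' theorem): Greenberg's
# second diagram (LNM 1716 pp. 107–108) for Sprung's `Sel♭(E/K_∞)` — «LIFT′ on `H¹(K_Σ/K_∞, E[p^∞])`» ⟸
# CASSELS (p. 104 / Prop. 4.13 p. 122, VERBATIM shape: a class of `H¹(K_Σ/K, E[p^∞])` with prescribed
# local classes on `Σ`) + the local lifts at the FINITE places of `Σ`; the archimedean lift is PROVED here

Seat `bsd-2adic-ss-1` GEN 12, crux `SupersingularRankZeroAtTwo` (item stmt-BirchSwinnertonDyer-19097, route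
`ByReductionTypeAtTwo`, rung K4), line `flat_uniform_two` v1, stub (2) `stub_allFlatData`, conjunct
COUNT♭@2 — part 7 of the series. Part 5 (`…FlatLiftAssembly`) reduced «LIFT′» to a layer-`0` lifting
statement phrased with `H¹(κ⁻¹(p⁰ℤ_p), E[p^∞])` and local classes prescribed at EVERY place; this file
restates the assembly in the EXACT currency of the printed Cassels theorem — the group `H¹(Γ_K, E[p^∞])`
(`W.subgroupH1 p ⊤`), the subgroup `H¹(K_Σ/K, E[p^∞])` of classes unramified outside
`Σ = Σ₀ ∪ {v ∣ p} ∪ ∞` (`unramifiedOutside ⊤ E[p^∞] p Σ₀`), and local classes prescribed ONLY on `Σ`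
(Greenberg p. 122: «coker(H¹(F_Σ/F, E[p^∞]) → ∏_{v∈Σ} H¹(F_v, E[p^∞])/Im(κ_v)) ≅ E(F)_p^ if `Sel_E(F)_p` is
finite») — and DISCHARGES the archimedean local lift inside the assembly (real places split completely
in a `ℤ_p`-extension, tree `ZpExtension.resGal_infinitePlace_mem_kerSubgroup`; Greenberg p. 107 «for
archimedean `v`, one easily verifies that `𝒫^{(v)}(F) ≅ 𝒫^{(v)}(F_∞)^Γ`», at `p = 2` included).

WHAT IS PROVED (namespace `…Theorems.SSFlatEC`; `K` a number field, prime `p`, CYCLOTOMIC `κ`, topological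
generator `γ`, `v₀ ∋ p` carrying the `•`-data, `Σ₀ ⊇` the bad places prime to `p`):
* §1 (any `K`, any `H ≤ H' ≤ Γ_K`) `resOfLe_mem_unramifiedKer` / `resOfLe_mem_unramifiedOutside` —
  restriction `H¹(H', M) → H¹(H, M)` preserves «unramified at the chosen place above `v`» (functoriality
  along `H ⊓ I_v ↪ H' ⊓ I_v`); so `res : H¹(K_Σ/K, E[p^∞]) → H¹(K_Σ/K_∞, E[p^∞])`.
* §2 `conjH1_resOfLe_top` — the restriction of a class of `H¹(Γ_K, E[p^∞])` to `H¹(K_∞, E[p^∞])` is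
  `Γ_K`-invariant; `exists_localLift_infinitePlace_top` — LOC∞ at level `Γ_K` (as in part 6).
* §3 `exists_sub_resOfLe_mem_sharpFlatSelmerInfty_of_cassels_top` — for `t ∈ H¹(K_Σ/K_∞, E[p^∞])` with
  `conj_σ t − t ∈ Sel^•` (all `σ`): (CASSELS, displayed) «for every family of `p`-power-torsion local
  classes `(x_v)_{v ∈ Σ₀ ∪ {v∣p}}`, `(x_w)_{w∣∞}` there is `y ∈ H¹(K_Σ/K, E[p^∞])` with `loc_v y = x_v`,
  `loc_w y = x_w`» ∧ (LOC at the finite `v ∈ Σ`, displayed; `•`-clause at `v₀`) ⇒ `t − res y ∈ Sel^•(E/K_∞)`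
  for some `y ∈ H¹(Γ_K, E[p^∞])`. Off `Σ`: `conj_σ t` and `res y` are unramified, hence Kummer over the
  cyclotomic tower (`GreenbergVatsalUnramifiedAway.unramKer_le_localKerOver_of_isCyclotomic`); at `∞`: §2.
* §4 `sharpFlatEndCoinvariants_subsingleton_of_cassels_top` — part 4's (a) ∧ (b) for
  `H¹(K_Σ/K_∞, E[p^∞])` ∧ CASSELS ∧ the finite local lifts ⇒ `(Sel^•(E/K_∞))_γ = 0`.
So «LIFT» = CASSELS (PRINT, Greenberg Prop. 4.13 + p. 122; to be typed VERBATIM as a Literature fact in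
this currency) + {LOC at `v ∈ Σ₀`, LOC♭ at `v₀`} (kernel-able: `cd_p Γ_η = 1`, `E((K_∞)_η) ⊗ ℚ_p/ℤ_p = 0`,
`(L♭)_Γ = 0`). HONEST FRAMING: CASSELS and the finite local lifts are displayed hypotheses, NOT proved
here; nothing about any curve is asserted; no census cell moves; BSD is not proved by any of this.

References: [GreenbergLNM1716] §3 p. 86, §4 p. 104, Lemma 4.7 pp. 107–108, Prop. 4.13 and p. 122;
[GreenbergVatsal2000] §2 pp. 16–17; [Cassels1964]; [MilneADT2006] I.6.13.
-/

set_option autoImplicit false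
-- the Theorems namespace of this sub repeats the summit name by design (D-0017 nested layout)
set_option linter.dupNamespace false

noncomputable section

open scoped Classical NumberField

open NumberField IsDedekindDomain

universe u

namespace Summit.BirchSwinnertonDyer.BirchSwinnertonDyer.Theorems.SSFlatEC

open Literature.NumberTheory.EllipticCurves Literature.NumberTheory.GaloisRepresentations
  WeierstrassCurve ZpExtension Literature.NumberTheory.EllipticCurves.Kobayashi2003
  Literature.NumberTheory.EllipticCurves.Sprung2017 Literature.NumberTheory.EllipticCurves.Sprung2012
  Literature.NumberTheory.EllipticCurves.Sprung2024 Literature.NumberTheory.EllipticCurves.IwasawaDual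
  Literature.NumberTheory.EllipticCurves.IwasawaAlgebra Literature.NumberTheory.EllipticCurves.GreenbergVatsal2000
  Literature.NumberTheory.EllipticCurves.GreenbergSelmer
  Literature.NumberTheory.EllipticCurves.Rank1Residual Summit.BirchSwinnertonDyer.Rank1Residual.X5.O1
  Summit.BirchSwinnertonDyer.Rank1Residual.X2

/-! ## §1 Restriction preserves «unramified outside `Σ`» -/

section Unramified

variable {K : Type u} [Field K] [NumberField K] {H H' : Subgroup (Field.absoluteGaloisGroup K)}
  (M : Type u) [AddCommGroup M] [DistribMulAction (Field.absoluteGaloisGroup K) M] [TopologicalSpace M]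
  [DiscreteTopology M]

/-- **Restriction preserves the unramified condition**: for `H ≤ H'` and a finite place `v`, if
`c ∈ H¹(H', M)` dies on `H' ⊓ I_v` then `res c ∈ H¹(H, M)` dies on `H ⊓ I_v` (both restrictions to
`H ⊓ I_v` are induced by the same map `H ⊓ I_v → H'`, `resH1Hom_comp`). [cite: GreenbergVatsal2000, §2 p. 16
(«H¹(ℚ_Σ/ℚ, A) → H¹(ℚ_Σ/ℚ_∞, A)»)] -/
theorem resOfLe_mem_unramifiedKer (h : H ≤ H') (v : HeightOneSpectrum (𝓞 K)) {c : subgroupH1 H' M}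
    (hc : c ∈ unramifiedKer H' M v) :
    Literature.NumberTheory.EllipticCurves.resOfLe M h c ∈ unramifiedKer H M v := by
  rw [GreenbergVatsal2000.unramifiedKer, AddMonoidHom.mem_ker] at hc ⊢
  -- the inclusion `H ⊓ I_v ↪ H' ⊓ I_v` (subgroups of `D_v`)
  have hincl : inertiaIn H v ≤ inertiaIn H' v := fun x hx ↦
    (mem_inertiaIn_iff H' v x).2 ⟨h ((mem_inertiaIn_iff H v x).1 hx).1, ((mem_inertiaIn_iff H v x).1 hx).2⟩
  -- `res_{H ⊓ I_v} ∘ res_{H/H'} = res_{(H ⊓ I_v)/(H' ⊓ I_v)} ∘ res_{H' ⊓ I_v}`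
  have e1 := congrArg (fun f ↦ f c)
    (resH1Hom_comp (Literature.NumberTheory.EllipticCurves.subgroupInclusion h) (AddMonoidHom.id M)
      (fun _ _ ↦ rfl) (inertiaInToH H v) (AddMonoidHom.id M) (fun _ _ ↦ rfl))
  have e2 := congrArg (fun f ↦ f c)
    (resH1Hom_comp (inertiaInToH H' v) (AddMonoidHom.id M) (fun _ _ ↦ rfl)
      (Literature.NumberTheory.EllipticCurves.subgroupInclusion hincl) (AddMonoidHom.id M) (fun _ _ ↦ rfl))
  have mid := congrArg (fun f ↦ f c)
    (resH1Hom_congr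
      (φ := (Literature.NumberTheory.EllipticCurves.subgroupInclusion h).comp (inertiaInToH H v))
      (φ' := (inertiaInToH H' v).comp (Literature.NumberTheory.EllipticCurves.subgroupInclusion hincl))
      (ψ := (AddMonoidHom.id M).comp (AddMonoidHom.id M)) (ψ' := (AddMonoidHom.id M).comp (AddMonoidHom.id M))
      (by ext; rfl) rfl (fun _ _ ↦ rfl) (fun _ _ ↦ rfl))
  simp only [AddMonoidHom.coe_comp, Function.comp_apply] at e1 e2
  change resH1Hom (inertiaInToH H v) (AddMonoidHom.id M) _
    (Literature.NumberTheory.EllipticCurves.resOfLe M h c) = 0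
  rw [Literature.NumberTheory.EllipticCurves.resOfLe, e1, mid, ← e2, hc, map_zero]

variable [H.Normal] [H'.Normal]

/-- **`res : H¹(H', M) → H¹(H, M)` maps `unramifiedOutside H' M p Σ₀` into `unramifiedOutside H M p Σ₀`**
(for every conjugate: `res ∘ conj_σ = conj_σ ∘ res`, `resOfLe_comp_conjH1`). In particular the image of
`H¹(K_Σ/K, E[p^∞])` in `H¹(K_∞, E[p^∞])` lies in `H¹(K_Σ/K_∞, E[p^∞])`. [cite: GreenbergVatsal2000, §2 p. 16] -/
theorem resOfLe_mem_unramifiedOutside (h : H ≤ H') (p : ℕ) (S₀ : Set (HeightOneSpectrum (𝓞 K)))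
    {c : subgroupH1 H' M} (hc : c ∈ unramifiedOutside H' M p S₀) :
    Literature.NumberTheory.EllipticCurves.resOfLe M h c ∈ unramifiedOutside H M p S₀ := by
  rw [mem_unramifiedOutside_iff] at hc ⊢
  intro v hv hpv σ
  have hcomm := congrArg (fun f ↦ f c) (resOfLe_comp_conjH1_holds (M := M) h σ)
  simp only [AddMonoidHom.coe_comp, Function.comp_apply] at hcomm
  rw [← hcomm]
  exact resOfLe_mem_unramifiedKer M h v (hc v hv hpv σ)

end Unramified

/-! ## §2 Level `Γ_K`: invariance of restricted classes; the archimedean local lift -/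

section Top

variable {K : Type u} [Field K] [NumberField K] (W : WeierstrassCurve K) {p : ℕ} [Fact p.Prime]
  (κ : ZpExtension K p)

omit [NumberField K] in
/-- The restriction of a class of `H¹(Γ_K, E[p^∞])` to `H¹(K_∞, E[p^∞])` is `Γ_K`-invariant:
`conj_σ ∘ res = res ∘ conj_σ` and `conj_σ = id` on `H¹(Γ_K, ·)` (inner automorphisms).
[cite: SerreLocalFields1979, VII.§5 Prop. 3] -/
theorem conjH1_resOfLe_top (σ : Field.absoluteGaloisGroup K)
    (y : W.subgroupH1 p (⊤ : Subgroup (Field.absoluteGaloisGroup K))) :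
    W.conjH1 p κ.kerSubgroup σ (W.resOfLe p (le_top : κ.kerSubgroup ≤ ⊤) y) =
      W.resOfLe p (le_top : κ.kerSubgroup ≤ ⊤) y := by
  have hcomm := congrArg (fun f ↦ f y)
    (resOfLe_comp_conjH1_holds (M := W.geomPrimaryTorsion p) (le_top : κ.kerSubgroup ≤ ⊤) σ)
  simp only [AddMonoidHom.coe_comp, Function.comp_apply] at hcomm
  have h1 : Literature.NumberTheory.EllipticCurves.conjH1 ⊤ (W.geomPrimaryTorsion p) σ = AddMonoidHom.id _ :=
    Literature.NumberTheory.EllipticCurves.conjH1_of_mem_holds ⊤ _ (Subgroup.mem_top σ)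
  rw [h1, AddMonoidHom.id_apply] at hcomm
  exact hcomm.symm

omit [NumberField K] in
/-- `loc_v(res y) = r_v(loc_v y)` at level `Γ_K`: if the local class of `y ∈ H¹(Γ_K, E[p^∞])` at the
chosen place above `v` vanishes, `res y` satisfies the classical local condition over `K_∞` there.
[cite: GreenbergLNM1716, §3 p. 86] -/
theorem resOfLe_top_mem_localKerOver_of_localResOver_eq_zero {E : Type u} [Field E] [Algebra K E]
    (y : W.subgroupH1 p (⊤ : Subgroup (Field.absoluteGaloisGroup K)))
    (hy : W.localResOver p ⊤ E y = 0) :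
    W.resOfLe p (le_top : κ.kerSubgroup ≤ ⊤) y ∈ W.localKerOver p κ.kerSubgroup E := by
  rw [mem_localKerOver_iff]
  have h := W.localResOverOfEmb_resOfLe p (closureEmb (K := K) E) (le_top : κ.kerSubgroup ≤ ⊤) y
  have hy' : W.localResOverOfEmb p ⊤ (closureEmb (K := K) E) y = 0 := hy
  exact h.trans ((congrArg _ hy').trans (map_zero _))

/-- **LOC∞ at level `Γ_K`**: for every `t ∈ H¹(K_∞, E[p^∞])` and infinite place `w` there is a
`p`-power-torsion `x_w ∈ H¹(Γ_{K_w}, E(K̄_w))` such that `loc_w y = x_w` forces `t − res y` to die in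
`H¹(H_{w,∞}, E(K̄_w))` — the real places split completely in `K_∞/K`, so the two local groups coincide
and `x_w = r_w⁻¹(loc_w t)`. [cite: GreenbergLNM1716, §4 p. 107 («𝒫^{(v)}(F) ≅ 𝒫^{(v)}(F_∞)^Γ» for
archimedean v) and p. 106 (p = 2)] -/
theorem exists_localLift_infinitePlace_top (w : InfinitePlace K) (t : W.subgroupH1 p κ.kerSubgroup) :
    ∃ xw : discreteH1 (localSubgroup (⊤ : Subgroup (Field.absoluteGaloisGroup K)) w.Completion)
        (localPoints W w.Completion),
      (∃ k : ℕ, p ^ k • xw = 0) ∧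
      ∀ y : W.subgroupH1 p (⊤ : Subgroup (Field.absoluteGaloisGroup K)),
        W.localResOver p ⊤ w.Completion y = xw →
        t - W.resOfLe p (le_top : κ.kerSubgroup ≤ ⊤) y ∈ W.localKerOver p κ.kerSubgroup w.Completion := by
  have hle : localSubgroup κ.kerSubgroup w.Completion ≤
      localSubgroup (⊤ : Subgroup (Field.absoluteGaloisGroup K)) w.Completion :=
    Subgroup.comap_mono le_top
  have hge : localSubgroup (⊤ : Subgroup (Field.absoluteGaloisGroup K)) w.Completion ≤
      localSubgroup κ.kerSubgroup w.Completion :=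
    fun τ _ ↦ (mem_localSubgroup_iff _ _ τ).mpr (ZpExtension.resGal_infinitePlace_mem_kerSubgroup κ w τ)
  let s := Literature.NumberTheory.EllipticCurves.resOfLe (localPoints W w.Completion) hge
  have hrs : ∀ z, Literature.NumberTheory.EllipticCurves.resOfLe (localPoints W w.Completion) hle (s z) = z :=
    fun z ↦ by
      have e : (Literature.NumberTheory.EllipticCurves.resOfLe (localPoints W w.Completion) hle).comp
          (Literature.NumberTheory.EllipticCurves.resOfLe (localPoints W w.Completion) hge) =
          AddMonoidHom.id _ := by
        rw [resOfLe_comp_holds (M := localPoints W w.Completion) hle hge]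
        exact resOfLe_refl_holds (M := localPoints W w.Completion) _
      exact DFunLike.congr_fun e z
  refine ⟨s (W.localResOver p κ.kerSubgroup w.Completion t), ?_, fun y hy ↦ ?_⟩
  · obtain ⟨k, hk⟩ := W.exists_pow_smul_subgroupH1_ker_eq_zero κ t
    exact ⟨k, by rw [← map_nsmul, ← map_nsmul, hk, map_zero, map_zero]⟩
  · rw [mem_localKerOver_iff, map_sub]
    have hnat := W.localResOverOfEmb_resOfLe p (closureEmb (K := K) w.Completion)
      (le_top : κ.kerSubgroup ≤ ⊤) y
    have hy' : W.localResOverOfEmb p ⊤ (closureEmb (K := K) w.Completion) y =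
        s (W.localResOver p κ.kerSubgroup w.Completion t) := hy
    have h0 : W.localResOver p κ.kerSubgroup w.Completion (W.resOfLe p (le_top : κ.kerSubgroup ≤ ⊤) y) =
        W.localResOver p κ.kerSubgroup w.Completion t :=
      hnat.trans ((congrArg _ hy').trans (hrs _))
    rw [h0, sub_self]

end Top

/-! ## §3 The assembly at level `Γ_K` -/

section Assembly

-- `K : Type` (universe `0`): the cyclotomic lemmas of `X2.GreenbergVatsalUnramifiedAway` are stated there.
variable {K : Type} [Field K] [NumberField K] (W : WeierstrassCurve K) [W.IsElliptic] {p : ℕ}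
  [Fact p.Prime] (κ : ZpExtension K p) {v₀ : HeightOneSpectrum (𝓞 K)} (ap : ℤ)
  (g : Field.absoluteGaloisGroup (v₀.adicCompletion K)) (c : ℕ → localPoints W (v₀.adicCompletion K))
  (col : Chroma)

/-- **The «LIFT» assembly at level `Γ_K` (Greenberg, LNM 1716 pp. 107–108, for `Sel^•`).** `κ` the
CYCLOTOMIC `ℤ_p`-extension of the number field `K`, `Σ₀` finite places off which (and off `p`) `E` has good
reduction, `v₀ ∋ p` the place of the `•`-data. Let `t ∈ H¹(K_Σ/K_∞, E[p^∞])` with `conj_σ t − t ∈ Sel^•`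
for all `σ`. Assume (CASSELS) every family of `p`-power-torsion local classes `(x_v)_{v ∈ Σ₀ ∪ {v∣p}}`,
`(x_w)_{w∣∞}` is realised by some `y ∈ H¹(K_Σ/K, E[p^∞])` (Greenberg p. 122: the cokernel of
`H¹(F_Σ/F, E[p^∞]) → ∏_{v∈Σ} H¹(F_v, E[p^∞])/Im κ_v` is `E(F)_p^`, `= 0` here), and (LOC) at every finite
`v ∈ Σ₀ ∪ {v∣p}` some `p`-power-torsion `x_v ∈ H¹(Γ_{K_v}, E(K̄_v))` has «`loc_v y = x_v` ⇒ `t − res y`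
classically Kummer at the chosen place above `v`, and `•`-Kummer at `v₀`». Then `t − res y ∈ Sel^•(E/K_∞)`
for some `y ∈ H¹(Γ_K, E[p^∞])` (the archimedean lift is §2; off `Σ` both `conj_σ t` and `res y` are
unramified, hence Kummer over the cyclotomic tower). [cite: GreenbergLNM1716, §4 Lemma 4.7 (pp. 107–108),
p. 104 and p. 122 (Cassels)] [cite: GreenbergVatsal2000, §2 p. 17] -/
theorem exists_sub_resOfLe_mem_sharpFlatSelmerInfty_of_cassels_top (hκ : κ.IsCyclotomic)
    (S₀ : Set (HeightOneSpectrum (𝓞 K)))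
    (hgood : ∀ v : HeightOneSpectrum (𝓞 K), v ∉ S₀ → ((p : ℕ) : 𝓞 K) ∉ v.asIdeal →
      W.HasGoodReductionAt v)
    {t : W.subgroupH1 p κ.kerSubgroup}
    (htH : t ∈ unramifiedOutside κ.kerSubgroup (W.geomPrimaryTorsion p) p S₀)
    (ht : ∀ σ : Field.absoluteGaloisGroup K, W.conjH1 p κ.kerSubgroup σ t - t ∈
      sharpFlatSelmerInfty W κ (closureEmb (K := K) (v₀.adicCompletion K)) ap g c col)
    (hCas : ∀ (x : ∀ v : HeightOneSpectrum (𝓞 K),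
        discreteH1 (localSubgroup (⊤ : Subgroup (Field.absoluteGaloisGroup K)) (v.adicCompletion K))
          (localPoints W (v.adicCompletion K)))
      (xi : ∀ w : InfinitePlace K,
        discreteH1 (localSubgroup (⊤ : Subgroup (Field.absoluteGaloisGroup K)) w.Completion)
          (localPoints W w.Completion)),
      (∀ v, ∃ k : ℕ, p ^ k • x v = 0) → (∀ w, ∃ k : ℕ, p ^ k • xi w = 0) →
      ∃ y : W.subgroupH1 p (⊤ : Subgroup (Field.absoluteGaloisGroup K)),
        y ∈ unramifiedOutside (⊤ : Subgroup (Field.absoluteGaloisGroup K)) (W.geomPrimaryTorsion p) p S₀ ∧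
        (∀ v, (v ∈ S₀ ∨ ((p : ℕ) : 𝓞 K) ∈ v.asIdeal) →
          W.localResOver p ⊤ (v.adicCompletion K) y = x v) ∧
        (∀ w, W.localResOver p ⊤ w.Completion y = xi w))
    (hloc : ∀ v : HeightOneSpectrum (𝓞 K), (v ∈ S₀ ∨ ((p : ℕ) : 𝓞 K) ∈ v.asIdeal) →
      ∃ xv : discreteH1 (localSubgroup (⊤ : Subgroup (Field.absoluteGaloisGroup K)) (v.adicCompletion K))
          (localPoints W (v.adicCompletion K)),
        (∃ k : ℕ, p ^ k • xv = 0) ∧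
        ∀ y : W.subgroupH1 p (⊤ : Subgroup (Field.absoluteGaloisGroup K)),
          W.localResOver p ⊤ (v.adicCompletion K) y = xv →
          t - W.resOfLe p (le_top : κ.kerSubgroup ≤ ⊤) y ∈
              W.localKerOver p κ.kerSubgroup (v.adicCompletion K) ∧
          (v = v₀ → t - W.resOfLe p (le_top : κ.kerSubgroup ≤ ⊤) y ∈
            sharpFlatLocalKummerOverOfEmb W p κ.kerSubgroup (closureEmb (K := K) (v₀.adicCompletion K))
              (localTowerPointsOfEmb κ (closureEmb (K := K) (v₀.adicCompletion K)) W)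
              (colemanKer κ (closureEmb (K := K) (v₀.adicCompletion K)) W ap g c col)))
    (hv₀ : ((p : ℕ) : 𝓞 K) ∈ v₀.asIdeal) :
    ∃ y : W.subgroupH1 p (⊤ : Subgroup (Field.absoluteGaloisGroup K)),
      t - W.resOfLe p (le_top : κ.kerSubgroup ≤ ⊤) y ∈
        sharpFlatSelmerInfty W κ (closureEmb (K := K) (v₀.adicCompletion K)) ap g c col := by
  -- local classes to prescribe: the chosen lifts on `Σ₀ ∪ {v ∣ p}` (anything, say `0`, elsewhere), and
  -- the archimedean lifts of §2
  let x : ∀ v : HeightOneSpectrum (𝓞 K),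
      discreteH1 (localSubgroup (⊤ : Subgroup (Field.absoluteGaloisGroup K)) (v.adicCompletion K))
        (localPoints W (v.adicCompletion K)) := fun v ↦
    if h : (v ∈ S₀ ∨ ((p : ℕ) : 𝓞 K) ∈ v.asIdeal) then Classical.choose (hloc v h) else 0
  have hx_of : ∀ v (h : v ∈ S₀ ∨ ((p : ℕ) : 𝓞 K) ∈ v.asIdeal), x v = Classical.choose (hloc v h) :=
    fun v h ↦ dif_pos h
  have hx_tor : ∀ v, ∃ k : ℕ, p ^ k • x v = 0 := fun v ↦ by
    by_cases h : (v ∈ S₀ ∨ ((p : ℕ) : 𝓞 K) ∈ v.asIdeal)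
    · rw [hx_of v h]; exact (Classical.choose_spec (hloc v h)).1
    · rw [show x v = 0 from dif_neg h]; exact ⟨0, smul_zero _⟩
  have hinf := fun w ↦ exists_localLift_infinitePlace_top W κ w t
  let xi : ∀ w : InfinitePlace K,
      discreteH1 (localSubgroup (⊤ : Subgroup (Field.absoluteGaloisGroup K)) w.Completion)
        (localPoints W w.Completion) := fun w ↦ Classical.choose (hinf w)
  obtain ⟨y, hyH, hyfin, hyinf⟩ := hCas x xi hx_tor (fun w ↦ (Classical.choose_spec (hinf w)).1)
  refine ⟨y, ?_⟩
  have hsplit : ∀ σ : Field.absoluteGaloisGroup K,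
      W.conjH1 p κ.kerSubgroup σ (t - W.resOfLe p (le_top : κ.kerSubgroup ≤ ⊤) y) =
        (W.conjH1 p κ.kerSubgroup σ t - t) + (t - W.resOfLe p (le_top : κ.kerSubgroup ≤ ⊤) y) := fun σ ↦ by
    rw [map_sub, conjH1_resOfLe_top W κ σ y]; abel
  have hsel' : ∀ σ, (∀ (v : HeightOneSpectrum (𝓞 K)) (τ : Field.absoluteGaloisGroup K),
      W.conjH1 p κ.kerSubgroup τ (W.conjH1 p κ.kerSubgroup σ t - t) ∈
        W.localKerOver p κ.kerSubgroup (v.adicCompletion K)) ∧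
      ∀ (w : InfinitePlace K) (τ : Field.absoluteGaloisGroup K),
        W.conjH1 p κ.kerSubgroup τ (W.conjH1 p κ.kerSubgroup σ t - t) ∈
          W.localKerOver p κ.kerSubgroup w.Completion := fun σ ↦
    (W.mem_selmerGroupOver_iff p κ.kerSubgroup _).mp
      (sharpFlatSelmerInfty_le_selmerInfty W κ _ ap g c col (ht σ))
  have hone : ∀ {A : AddSubgroup (W.subgroupH1 p κ.kerSubgroup)} {s : W.subgroupH1 p κ.kerSubgroup},
      W.conjH1 p κ.kerSubgroup 1 s ∈ A → s ∈ A := fun {A s} h ↦ by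
    rwa [W.conjH1_one_holds p κ.kerSubgroup, AddMonoidHom.id_apply] at h
  have hSig : ∀ v : HeightOneSpectrum (𝓞 K), (v ∈ S₀ ∨ ((p : ℕ) : 𝓞 K) ∈ v.asIdeal) →
      t - W.resOfLe p (le_top : κ.kerSubgroup ≤ ⊤) y ∈ W.localKerOver p κ.kerSubgroup (v.adicCompletion K) ∧
      (v = v₀ → t - W.resOfLe p (le_top : κ.kerSubgroup ≤ ⊤) y ∈
        sharpFlatLocalKummerOverOfEmb W p κ.kerSubgroup (closureEmb (K := K) (v₀.adicCompletion K))
          (localTowerPointsOfEmb κ (closureEmb (K := K) (v₀.adicCompletion K)) W)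
          (colemanKer κ (closureEmb (K := K) (v₀.adicCompletion K)) W ap g c col)) := fun v h ↦
    (Classical.choose_spec (hloc v h)).2 y (by rw [hyfin v h, hx_of v h])
  -- `res y ∈ H¹(K_Σ/K_∞, E[p^∞])`
  have hyH' : W.resOfLe p (le_top : κ.kerSubgroup ≤ ⊤) y ∈
      unramifiedOutside κ.kerSubgroup (W.geomPrimaryTorsion p) p S₀ :=
    resOfLe_mem_unramifiedOutside (W.geomPrimaryTorsion p) (le_top : κ.kerSubgroup ≤ ⊤) p S₀ hyH
  rw [mem_sharpFlatSelmerInfty_iff]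
  refine ⟨(W.mem_selmerGroupOver_iff p κ.kerSubgroup _).mpr ⟨fun v σ ↦ ?_, fun w σ ↦ ?_⟩, fun σ ↦ ?_⟩
  · rw [hsplit σ]
    refine AddSubgroup.add_mem _ (hone ((hsel' σ).1 v 1)) ?_
    by_cases h : (v ∈ S₀ ∨ ((p : ℕ) : 𝓞 K) ∈ v.asIdeal)
    · exact (hSig v h).1
    · obtain ⟨hv, hpv⟩ := not_or.mp h
      have h1 : W.conjH1 p κ.kerSubgroup 1 t ∈ W.localKerOver p κ.kerSubgroup (v.adicCompletion K) :=
        GreenbergVatsalUnramifiedAway.unramKer_le_localKerOver_of_isCyclotomic (κ := κ) (v := v)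
          (W := W) (p := p) hκ (hgood v hv hpv) hpv ((mem_unramifiedOutside_iff t).mp htH v hv hpv 1)
      have h2 : W.conjH1 p κ.kerSubgroup 1 (W.resOfLe p (le_top : κ.kerSubgroup ≤ ⊤) y) ∈
          W.localKerOver p κ.kerSubgroup (v.adicCompletion K) :=
        GreenbergVatsalUnramifiedAway.unramKer_le_localKerOver_of_isCyclotomic (κ := κ) (v := v)
          (W := W) (p := p) hκ (hgood v hv hpv) hpv ((mem_unramifiedOutside_iff _).mp hyH' v hv hpv 1)
      exact AddSubgroup.sub_mem _ (hone h1) (hone h2)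
  · rw [hsplit σ]
    refine AddSubgroup.add_mem _ (hone ((hsel' σ).2 w 1)) ?_
    exact (Classical.choose_spec (hinf w)).2 y (hyinf w)
  · rw [hsplit σ]
    refine AddSubgroup.add_mem _ ?_ ((hSig v₀ (Or.inr hv₀)).2 rfl)
    exact hone (((mem_sharpFlatSelmerInfty_iff W κ _ ap g c col _).mp (ht σ)).2 1)

/-- **`(Sel^•(E/K_∞))_γ = 0` from: part 4's (a) ∧ (b) for `H¹(K_Σ/K_∞, E[p^∞])`, CASSELS at level
`Γ_K`, and the local lifts at the finite places of `Σ`** (cyclotomic `κ`, topological generator `γ`;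
the `γ`-to-`Γ_K` upgrade is GEN 11's `conjH1_sub_mem_of_conjH1_generator_sub_mem`, the chase is part
4's `sharpFlatEndCoinvariants_subsingleton_of_ambient_noFinite` with the invariant class `res y`,
§2). [cite: GreenbergLNM1716, §4 pp. 104, 107–109, 119, 122] -/
theorem sharpFlatEndCoinvariants_subsingleton_of_cassels_top (hκ : κ.IsCyclotomic)
    {γ : Field.absoluteGaloisGroup K} (hγ : κ.IsTopGenerator γ) (S₀ : Set (HeightOneSpectrum (𝓞 K)))
    (hgood : ∀ v : HeightOneSpectrum (𝓞 K), v ∉ S₀ → ((p : ℕ) : 𝓞 K) ∉ v.asIdeal →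
      W.HasGoodReductionAt v)
    (hv₀ : ((p : ℕ) : 𝓞 K) ∈ v₀.asIdeal)
    (hle : sharpFlatSelmerInfty W κ (closureEmb (K := K) (v₀.adicCompletion K)) ap g c col ≤
      unramifiedOutside κ.kerSubgroup (W.geomPrimaryTorsion p) p S₀)
    {Y : Type*} [AddCommGroup Y] [Module (IwasawaAlgebra p) Y]
    (dY : Y →+ (unramifiedOutside κ.kerSubgroup (W.geomPrimaryTorsion p) p S₀ →+ AddCircle (1 : ℚ)))
    (hbij : Function.Bijective dY)
    (hT : ∀ (y : Y) (x : unramifiedOutside κ.kerSubgroup (W.geomPrimaryTorsion p) p S₀),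
      dY ((PowerSeries.X : IwasawaAlgebra p) • y) x =
        dY y ⟨W.conjH1 p κ.kerSubgroup γ x,
          conjH1_mem_unramifiedOutside κ.kerSubgroup (W.geomPrimaryTorsion p) p _ γ x.2⟩ - dY y x)
    (hC : ∀ (a : ℤ_[p]) (y : Y) (x : unramifiedOutside κ.kerSubgroup (W.geomPrimaryTorsion p) p S₀)
      (k : ℕ), (p ^ k) • x = 0 → dY (PowerSeries.C a • y) x = (PadicInt.toZModPow k a).val • dY y x)
    (hY : ∀ N : Submodule (IwasawaAlgebra p) Y, Finite N → N = ⊥)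
    (hfin : Finite (invariants p Y))
    (hCas : ∀ (x : ∀ v : HeightOneSpectrum (𝓞 K),
        discreteH1 (localSubgroup (⊤ : Subgroup (Field.absoluteGaloisGroup K)) (v.adicCompletion K))
          (localPoints W (v.adicCompletion K)))
      (xi : ∀ w : InfinitePlace K,
        discreteH1 (localSubgroup (⊤ : Subgroup (Field.absoluteGaloisGroup K)) w.Completion)
          (localPoints W w.Completion)),
      (∀ v, ∃ k : ℕ, p ^ k • x v = 0) → (∀ w, ∃ k : ℕ, p ^ k • xi w = 0) →
      ∃ y : W.subgroupH1 p (⊤ : Subgroup (Field.absoluteGaloisGroup K)),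
        y ∈ unramifiedOutside (⊤ : Subgroup (Field.absoluteGaloisGroup K)) (W.geomPrimaryTorsion p) p S₀ ∧
        (∀ v, (v ∈ S₀ ∨ ((p : ℕ) : 𝓞 K) ∈ v.asIdeal) →
          W.localResOver p ⊤ (v.adicCompletion K) y = x v) ∧
        (∀ w, W.localResOver p ⊤ w.Completion y = xi w))
    (hloc : ∀ t ∈ unramifiedOutside κ.kerSubgroup (W.geomPrimaryTorsion p) p S₀,
      (∀ σ : Field.absoluteGaloisGroup K, W.conjH1 p κ.kerSubgroup σ t - t ∈
        sharpFlatSelmerInfty W κ (closureEmb (K := K) (v₀.adicCompletion K)) ap g c col) →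
      ∀ v : HeightOneSpectrum (𝓞 K), (v ∈ S₀ ∨ ((p : ℕ) : 𝓞 K) ∈ v.asIdeal) →
      ∃ xv : discreteH1 (localSubgroup (⊤ : Subgroup (Field.absoluteGaloisGroup K)) (v.adicCompletion K))
          (localPoints W (v.adicCompletion K)),
        (∃ k : ℕ, p ^ k • xv = 0) ∧
        ∀ y : W.subgroupH1 p (⊤ : Subgroup (Field.absoluteGaloisGroup K)),
          W.localResOver p ⊤ (v.adicCompletion K) y = xv →
          t - W.resOfLe p (le_top : κ.kerSubgroup ≤ ⊤) y ∈
              W.localKerOver p κ.kerSubgroup (v.adicCompletion K) ∧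
          (v = v₀ → t - W.resOfLe p (le_top : κ.kerSubgroup ≤ ⊤) y ∈
            sharpFlatLocalKummerOverOfEmb W p κ.kerSubgroup (closureEmb (K := K) (v₀.adicCompletion K))
              (localTowerPointsOfEmb κ (closureEmb (K := K) (v₀.adicCompletion K)) W)
              (colemanKer κ (closureEmb (K := K) (v₀.adicCompletion K)) W ap g c col))) :
    Subsingleton (EndCoinvariants
      (conjSharpFlatSelmerInfty W κ (closureEmb (K := K) (v₀.adicCompletion K)) ap g c col γ - 1)) := by
  refine sharpFlatEndCoinvariants_subsingleton_of_ambient_noFinite W κ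
    (closureEmb (K := K) (v₀.adicCompletion K)) ap g c col γ hγ
    (unramifiedOutside κ.kerSubgroup (W.geomPrimaryTorsion p) p S₀)
    (fun x hx ↦ conjH1_mem_unramifiedOutside κ.kerSubgroup (W.geomPrimaryTorsion p) p _ γ hx) hle dY hbij
    hT hC hY hfin fun t htH htγ ↦ ?_
  have htall : ∀ σ : Field.absoluteGaloisGroup K, W.conjH1 p κ.kerSubgroup σ t - t ∈
      sharpFlatSelmerInfty W κ (closureEmb (K := K) (v₀.adicCompletion K)) ap g c col :=
    conjH1_sub_mem_of_conjH1_generator_sub_mem W κ hγ _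
      (fun σ s hs ↦ conjH1_mem_sharpFlatSelmerInfty W κ _ ap g c col σ hs) htγ
  obtain ⟨y, hy⟩ := exists_sub_resOfLe_mem_sharpFlatSelmerInfty_of_cassels_top W κ ap g c col hκ S₀
    hgood htH htall hCas (hloc t htH htall) hv₀
  exact ⟨W.resOfLe p (le_top : κ.kerSubgroup ≤ ⊤) y, conjH1_resOfLe_top W κ γ y, hy⟩

end Assembly

end Summit.BirchSwinnertonDyer.BirchSwinnertonDyer.Theorems.SSFlatEC

end
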